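import Summits.QuantumFields.YangMills.Theorems.GradientFlowWitnessFlowedResponseFloorDefs
import Summits.QuantumFields.YangMills.Theorems.BalabanLadderNTCouplingSumRuleBudget
import HarnessLib

/-!
# Route `GradientFlowWitness`, crux `FlowedResponseFloor` (stmt-QuantumFields-25684): the flowed response is
# `O((2L+1)⁸ log β / β)` at deep weak coupling — uniformly in the volume and in the unit (hypothesis-free)

Helper file of the prover seat `ym-line-gfw-p1` (gen 2) on the deciding crux
`Summit.QuantumFields.YangMills.Theses.GradientFlowWitness.FlowedResponseFloor` (`--supports stmt-QuantumFields-25684`;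
R3/RECORD framing).  The crux floors the flowed response `resp G r a ρ₀ w v β L = Cov_T(X̂_w∘Θ₀, Ṽ_v)` of the landed
vocabulary `Theorems/GradientFlowWitnessFlowedResponseFloorDefs` (`probe` = the femto-flowed energy of the mirror-doubled
configuration, `leg` = the bare smeared action density) along SOME unit `a(β) → 0`.  This file proves, for EVERY compact
gauge group `G`, every lattice representation `r`, every unit `a`, every flow radius and all Schwartz weights, the
elementary deep-weak-coupling CEILING

  `|resp(β, L)| ≤ K · (2L+1)⁸ · (1 + log β)/β`   (`β ≥ 1`, odd tori `2L+1 ≥ 3`; `K = K(G, r, ρ₀, sup|w|, sup|v|)`),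

`abs_resp_le_weakCoupling`.  Ingredients (all in the tree): unitarity along Lüscher's torus Wilson flow
(`matrixWilsonFlow_mem_unitaryGroup`) gives the POINTWISE bound `|E_t(x)| ≤ 64N` on the flowed density
(`abs_flowedEnergy_le`), hence `|X̂_w| ≤ 64N ρ₀⁴ sup|w| · (2L+1)⁴` (`abs_probe_le`) — the mirror-doubled configuration's
cold antipodal sheet costs nothing here; the bare leg deviates from its frozen value `6N Σ_y v(a y)` by at most
`sup|v| · Σ_y (6N − dens_y)` (`abs_leg_sub_le`), whose mean is `≤ sup|v| (2L+1)⁴ · 6K₀(1 + log β)/β` by the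
volume-uniform weak-coupling budget of the mean plaquette (19353 g8's `CouplingSumRule.exists_six_mul_sub_torusE_dens_le`,
from the tree's chessboard/Laplace estimate); and the covariance of a bounded observable against `Ṽ_v` is at most
`2 sup|X̂| · E_T|Ṽ_v − const|` (`abs_torusCov_le`, reflection invariance `torusE_comp_cfgReflect`).

HONEST FRAMING.  A CEILING in the corner `(2L+1)⁸ ≪ β/log β` only: it says the response dies when `β → ∞` much faster
than the torus (in lattice units) grows — the regime of units decaying slower than any `(log β/β)^{1/8}` — and is void on
tori of physical size (`L ≍ ξ(β) ≍ e^{+β/(4Nb₀)}`), where the crux lives.  Its use is the unit-pinning theorem of the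
sequel `Theorems/GradientFlowWitnessFlowedResponseFloorUnitPinning`.  Nothing here is a floor; nothing of
`FlowedResponseFloor`, `stub_window`, `BalabanLadder.NT`, any OS leg or the Yang–Mills mass gap is proved or claimed.
Refs: Lüscher, JHEP 08 (2010) 071, eqs. (1.4), (3.1), App. C; Friedli–Velenik (2017) Lemma 3.5 / App. B.8.1 and
Chatterjee arXiv:1602.01222 Thm. 2.1 for the weak-coupling mean-plaquette law (via the tree).
-/

set_option autoImplicit false

noncomputable section

open scoped BigOperators Topology Matrix
open Filter MeasureTheory
open Literature.MathematicalPhysics.QuantumFieldTheory hiding ZdEdge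
open Literature.MathematicalPhysics.QuantumLattice
open Literature.Probability.LatticeModels (box mem_box card_box)
open Summit.QuantumFields.YangMills.Cruxes.OSLegsFromFemtoAndGap.DlrCollarTransfer
open Summit.QuantumFields.YangMills.Cruxes.NT.ConjugateResponse (torusE_comp_cfgReflect)
open Summit.QuantumFields.YangMills.Cruxes.NT.CouplingSumRule (exists_six_mul_sub_torusE_dens_le)
open Summit.QuantumFields.YangMills.Cruxes.NT.MarkovMirror (continuous_cfgReflect)
open Summit.QuantumFields.YangMills.Cruxes.UVSeamRec.ResponsePinning (torusE_mono torusE_const torusE_add'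
  torusE_const_mul' integrable_comp_lift)
open Summit.QuantumFields.YangMills.Theorems (InfiniteVolume.abs_torusE_le)

namespace Summit.QuantumFields.YangMills.Cruxes.FlowedResponseFloor.WindowSplit

/-! ## §1 The flowed energy is bounded by `64 N` pointwise (unitarity along the Wilson flow) -/

section FlowBound

variable {G : Type} [Group G]

/-- The flowed plaquette matrix is unitary (unitarity is preserved along Lüscher's flow on a finite torus, tree
`matrixWilsonFlow_mem_unitaryGroup`). [cite: Luscher2010, App. C eq. (C.1)] -/
theorem flowedPlaquette_mem_unitaryGroup {N : ℕ} (ρ : G →* Matrix (Fin N) (Fin N) ℂ)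
    (hρ : ∀ g, ρ g ∈ Matrix.unitaryGroup (Fin N) ℂ) {L : ℕ} [NeZero L] (t : ℝ)
    (W : GaugeConfig 4 L G) (x : Site 4 L) (μ ν : Fin 4) :
    flowedPlaquette ρ t W x μ ν ∈ Matrix.unitaryGroup (Fin N) ℂ := by
  have hu : ∀ e, wilsonFlowMatrix ρ t W e ∈ Matrix.unitaryGroup (Fin N) ℂ := fun e =>
    matrixWilsonFlow_mem_unitaryGroup (by rintro _ ⟨g, rfl⟩; exact hρ g) (fun e => hρ (W e)) t e
  have hs : ∀ e, (wilsonFlowMatrix ρ t W e)ᴴ ∈ Matrix.unitaryGroup (Fin N) ℂ := fun e => by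
    rw [← Matrix.star_eq_conjTranspose]
    exact Unitary.star_mem (hu e)
  unfold flowedPlaquette
  exact mul_mem (mul_mem (mul_mem (hu _) (hu _)) (hs _)) (hs _)

/-- **Pointwise bound on the flowed action density**: `|E_t(x)[W]| ≤ 64 N` for every configuration `W` of a finite
four-torus, every flow time and every site (each of the `16` summands `N − Re tr V_t(p)` or `0` has modulus `≤ 2N`).
[cite: Luscher2010, eq. (3.1)] -/
theorem abs_flowedEnergy_le {N : ℕ} (ρ : G →* Matrix (Fin N) (Fin N) ℂ)
    (hρ : ∀ g, ρ g ∈ Matrix.unitaryGroup (Fin N) ℂ) {L : ℕ} [NeZero L] (t : ℝ)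
    (x : Site 4 L) (W : GaugeConfig 4 L G) :
    |flowedEnergy ρ t x W| ≤ 64 * N := by
  unfold flowedEnergy
  have hterm : ∀ μ ν : Fin 4,
      |(if μ < ν then ((N : ℝ) - (flowedPlaquette ρ t W x μ ν).trace.re) else 0)| ≤ 2 * N := by
    intro μ ν
    split_ifs
    · have h := abs_le.1 (abs_re_trace_le_of_mem_unitaryGroup
        (flowedPlaquette_mem_unitaryGroup ρ hρ t W x μ ν))
      rw [abs_le]
      constructor <;> linarith [h.1, h.2]
    · simp only [abs_zero]; positivity
  have hsum : |∑ μ : Fin 4, ∑ ν : Fin 4,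
      (if μ < ν then ((N : ℝ) - (flowedPlaquette ρ t W x μ ν).trace.re) else 0)| ≤
      ∑ _μ : Fin 4, ∑ _ν : Fin 4, (2 * (N : ℝ)) :=
    (Finset.abs_sum_le_sum_abs _ _).trans (Finset.sum_le_sum fun μ _ =>
      (Finset.abs_sum_le_sum_abs _ _).trans (Finset.sum_le_sum fun ν _ => hterm μ ν))
  simp only [Finset.sum_const, Finset.card_univ, Fintype.card_fin, nsmul_eq_mul] at hsum
  push_cast at hsum
  rw [abs_mul, abs_two]
  linarith

end FlowBound

/-! ## §2 The probe is `O((2L+1)⁴)` pointwise; the leg deviates from its frozen value by the local action -/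

section Observables

variable {G : Type} [Group G] [TopologicalSpace G]

/-- **Sup bound on the flowed probe**: `|X̂_w(U)| ≤ (2L+1)⁴ · C_w ρ₀⁴ · 64N` whenever `|w| ≤ C_w`. -/
theorem abs_probe_le (r : LatticeRep G) (a : ℝ → ℝ) (ρ₀ : ℝ) (w : SchwartzMap (EuclideanSpace ℝ (Fin 4)) ℝ)
    {Cw : ℝ} (hw : ∀ z, |w z| ≤ Cw) (β : ℝ) (L : ℕ) (U : LGConfig 4 G) :
    |probe G r a ρ₀ w β L U| ≤ ((2 * L + 1 : ℕ) : ℝ) ^ 4 * (Cw * (ρ₀ ^ 4 * (64 * r.N))) := by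
  unfold probe
  refine (Finset.abs_sum_le_sum_abs _ _).trans ?_
  have hterm : ∀ x ∈ box 4 L, |w (a β • siteToE x) * (ρ₀ ^ 4 *
      flowedEnergy r.ρ ((ρ₀ / a β) ^ 2) (fun i => ((x i : ℤ) : ZMod (2 * L + 1))) (mirrorDouble G L U))| ≤
      Cw * (ρ₀ ^ 4 * (64 * r.N)) := by
    intro x _
    rw [abs_mul, abs_mul, abs_of_nonneg (by positivity : (0 : ℝ) ≤ ρ₀ ^ 4)]
    refine mul_le_mul (hw _) (mul_le_mul_of_nonneg_left (abs_flowedEnergy_le r.ρ r.mem_unitary _ _ _)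
      (by positivity)) (by positivity) ((abs_nonneg (w (a β • siteToE x))).trans (hw _))
  refine (Finset.sum_le_sum hterm).trans ?_
  rw [Finset.sum_const, card_box, nsmul_eq_mul]
  push_cast
  exact le_rfl

variable [IsTopologicalGroup G] [CompactSpace G] [MeasurableSpace G] [BorelSpace G]

/-- The action density is at most `6N` pointwise (`Re tr ρ(g) ≤ N` for unitary `ρ(g)`, six planes). [folklore] -/
theorem dens_le_six_mul (r : LatticeRep G) (x : Fin 4 → ℤ) (U : LGConfig 4 G) :
    dens G r x U ≤ 6 * r.N := by
  change actionDensity r.ρ (configShift (-x) U) ≤ _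
  unfold actionDensity
  have hle : ∀ i j : Fin 4, (if i < j then plaquetteObs r.ρ 0 i j (configShift (-x) U) else 0) ≤
      (if i < j then (r.N : ℝ) else 0) := by
    intro i j
    split_ifs
    · exact Literature.Barriers.QuantumFields.re_trace_le_of_mem_unitaryGroup (r.mem_unitary _)
    · exact le_rfl
  refine (Finset.sum_le_sum fun i _ => Finset.sum_le_sum fun j _ => hle i j).trans (le_of_eq ?_)
  simp [Fin.sum_univ_four]
  ring

/-- **Deviation of the bare leg from its frozen value**: `|Ṽ_v(U) − 6N Σ_y v(a y)| ≤ C_v Σ_{y ∈ box L} (6N − dens_y U)`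
whenever `|v| ≤ C_v` (each `6N − dens_y ≥ 0`). -/
theorem abs_leg_sub_le (r : LatticeRep G) (a : ℝ → ℝ) (v : SchwartzMap (EuclideanSpace ℝ (Fin 4)) ℝ)
    {Cv : ℝ} (hv : ∀ z, |v z| ≤ Cv) (β : ℝ) (L : ℕ) (U : LGConfig 4 G) :
    |leg G r a v β L U - 6 * r.N * ∑ y ∈ box 4 L, v (a β • siteToE y)| ≤
      Cv * ∑ y ∈ box 4 L, (6 * r.N - dens G r y U) := by
  unfold leg
  rw [Finset.mul_sum, ← Finset.sum_sub_distrib, Finset.mul_sum]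
  refine (Finset.abs_sum_le_sum_abs _ _).trans (Finset.sum_le_sum fun y _ => ?_)
  have h0 : 0 ≤ 6 * (r.N : ℝ) - dens G r y U := sub_nonneg.2 (dens_le_six_mul r y U)
  have : v (a β • siteToE y) * dens G r y U - 6 * r.N * v (a β • siteToE y) =
      -(v (a β • siteToE y) * (6 * r.N - dens G r y U)) := by ring
  rw [this, abs_neg, abs_mul, abs_of_nonneg h0]
  exact mul_le_mul_of_nonneg_right (hv _) h0

end Observables

/-! ## §3 Torus covariance against a bounded observable; the response bound -/

section Torus

variable (G : Type) [Group G] [TopologicalSpace G] [IsTopologicalGroup G] [CompactSpace G]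
  [MeasurableSpace G] [BorelSpace G] (r : LatticeRep G)

/-- Finite additivity of the torus expectation over continuous observables. [folklore] -/
theorem torusE_finset_sum (β : ℝ) (L : ℕ) {ι : Type} (s : Finset ι) (f : ι → LGConfig 4 G → ℝ)
    (hf : ∀ i ∈ s, Continuous (f i)) :
    torusE G r β L (fun U => ∑ i ∈ s, f i U) = ∑ i ∈ s, torusE G r β L (f i) := by
  classical
  induction s using Finset.induction_on with
  | empty => simp only [Finset.sum_empty]; exact torusE_const r β L 0
  | insert i s hi ih =>
    have hfi : Continuous (f i) := hf i (Finset.mem_insert_self _ _)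
    have hfs : ∀ j ∈ s, Continuous (f j) := fun j hj => hf j (Finset.mem_insert_of_mem hj)
    have hcs : Continuous fun U => ∑ j ∈ s, f j U := continuous_finsetSum _ fun j hj => hfs j hj
    simp only [Finset.sum_insert hi]
    rw [torusE_add' r β L hfi hcs, ih hfs]

/-- **Covariance against a bounded observable.**  For continuous `F`, `V` with `|F| ≤ K` and any constant `b`:
`|E_T[F·V] − E_T[F]·E_T[V]| ≤ 2K · E_T|V − b|`. [folklore] -/
theorem abs_torusCov_le (β : ℝ) (L : ℕ) {F V : LGConfig 4 G → ℝ} (hF : Continuous F) (hV : Continuous V)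
    {K : ℝ} (hK : ∀ U, |F U| ≤ K) (b : ℝ) :
    |torusE G r β L (fun U => F U * V U) - torusE G r β L F * torusE G r β L V| ≤
      2 * K * torusE G r β L (fun U => |V U - b|) := by
  have hK0 : 0 ≤ K := (abs_nonneg _).trans (hK (fun _ => 1))
  have hFV : Continuous fun U => F U * V U := hF.mul hV
  have hVb : Continuous fun U => V U - b := hV.sub continuous_const
  have hFVb : Continuous fun U => F U * (V U - b) := hF.mul hVb
  have habs : Continuous fun U => |V U - b| := hVb.abs
  -- recentre `V`
  have e1 : torusE G r β L (fun U => F U * (V U - b)) = torusE G r β L (fun U => F U * V U) - b * torusE G r β L F := by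
    have : (fun U => F U * (V U - b)) = fun U => F U * V U + (-b) * F U := by funext U; ring
    have hbF : Continuous fun U => (-b) * F U := continuous_const.mul hF
    rw [this, torusE_add' r β L hFV hbF, torusE_const_mul']
    ring
  have e2 : torusE G r β L (fun U => V U - b) = torusE G r β L V - b := by
    have : (fun U => V U - b) = fun U => V U + (-b) := by funext U; ring
    have hcb : Continuous fun _ : LGConfig 4 G => (-b) := continuous_const
    rw [this, torusE_add' r β L hV hcb, torusE_const]
    ring
  have e3 : torusE G r β L (fun U => F U * V U) - torusE G r β L F * torusE G r β L V =
      torusE G r β L (fun U => F U * (V U - b)) - torusE G r β L F * torusE G r β L (fun U => V U - b) := by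
    rw [e1, e2]; ring
  rw [e3]
  -- the three elementary bounds
  have h1 : |torusE G r β L (fun U => F U * (V U - b))| ≤ K * torusE G r β L (fun U => |V U - b|) := by
    rw [← torusE_const_mul', abs_le]
    have hp : ∀ U, |F U * (V U - b)| ≤ K * |V U - b| := fun U => by
      rw [abs_mul]; exact mul_le_mul_of_nonneg_right (hK U) (abs_nonneg _)
    have hKabs : Continuous fun U => K * |V U - b| := continuous_const.mul habs
    have hKabs' : Continuous fun U => -(K * |V U - b|) := hKabs.neg
    constructor
    · have h := torusE_mono r β L hKabs' hFVb fun U => (abs_le.1 (hp U)).1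
      have e : torusE G r β L (fun U => -(K * |V U - b|)) = -torusE G r β L (fun U => K * |V U - b|) := by
        unfold torusE; exact integral_neg _
      rwa [e] at h
    · exact torusE_mono r β L hFVb hKabs fun U => (abs_le.1 (hp U)).2
  have h2 : |torusE G r β L F| ≤ K := InfiniteVolume.abs_torusE_le r β L hK
  have h3 : |torusE G r β L (fun U => V U - b)| ≤ torusE G r β L (fun U => |V U - b|) := by
    rw [abs_le]
    have habs' : Continuous fun U => -|V U - b| := habs.neg
    constructor
    · have h := torusE_mono r β L habs' hVb fun U => neg_abs_le _
      have e : torusE G r β L (fun U => -|V U - b|) = -torusE G r β L (fun U => |V U - b|) := by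
        unfold torusE; exact integral_neg _
      rwa [e] at h
    · exact torusE_mono r β L hVb habs fun U => le_abs_self _
  have h0 : 0 ≤ torusE G r β L (fun U => |V U - b|) := by
    have h := torusE_mono r β L continuous_const habs fun U => abs_nonneg (V U - b)
    rwa [torusE_const] at h
  calc |torusE G r β L (fun U => F U * (V U - b)) - torusE G r β L F * torusE G r β L (fun U => V U - b)|
      ≤ |torusE G r β L (fun U => F U * (V U - b))| + |torusE G r β L F * torusE G r β L (fun U => V U - b)| :=
        abs_sub _ _
    _ ≤ K * torusE G r β L (fun U => |V U - b|) + K * torusE G r β L (fun U => |V U - b|) := by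
        rw [abs_mul]
        exact add_le_add h1 (mul_le_mul h2 h3 (abs_nonneg _) hK0)
    _ = 2 * K * torusE G r β L (fun U => |V U - b|) := by ring

/-- `torusE (c − F) = c − torusE F` for continuous `F`. [folklore] -/
theorem torusE_const_sub (β : ℝ) (L : ℕ) (c : ℝ) {F : LGConfig 4 G → ℝ} (hF : Continuous F) :
    torusE G r β L (fun U => c - F U) = c - torusE G r β L F := by
  have e : (fun U => c - F U) = fun U => c + (-1) * F U := by funext U; ring
  have h1 : Continuous fun _ : LGConfig 4 G => c := continuous_const
  have h2 : Continuous fun U => (-1) * F U := continuous_const.mul hF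
  rw [e, torusE_add' r β L h1 h2, torusE_const, torusE_const_mul']
  ring

/-- **Mean deviation of the bare leg from its frozen value**:
`E_T|Ṽ_v − 6N Σ_y v(a y)| ≤ C_v Σ_{y ∈ box L} (6N − E_T[dens_y])`. -/
theorem torusE_abs_leg_sub_le (a : ℝ → ℝ) (v : SchwartzMap (EuclideanSpace ℝ (Fin 4)) ℝ) {Cv : ℝ}
    (hv : ∀ z, |v z| ≤ Cv) (β : ℝ) (L : ℕ) :
    torusE G r β L (fun U => |leg G r a v β L U - 6 * r.N * ∑ y ∈ box 4 L, v (a β • siteToE y)|) ≤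
      Cv * ∑ y ∈ box 4 L, (6 * r.N - torusE G r β L (dens G r y)) := by
  have hc1 : Continuous fun U => |leg G r a v β L U - 6 * r.N * ∑ y ∈ box 4 L, v (a β • siteToE y)| :=
    ((continuous_leg r a v β L).sub continuous_const).abs
  have hcs : Continuous fun U => ∑ y ∈ box 4 L, (6 * (r.N : ℝ) - dens G r y U) :=
    continuous_finsetSum _ fun y _ => continuous_const.sub (continuous_dens r y)
  have hc2 : Continuous fun U => Cv * ∑ y ∈ box 4 L, (6 * (r.N : ℝ) - dens G r y U) :=
    continuous_const.mul hcs
  refine (torusE_mono r β L hc1 hc2 fun U => abs_leg_sub_le r a v hv β L U).trans (le_of_eq ?_)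
  rw [torusE_const_mul', torusE_finset_sum G r β L (box 4 L) (fun y U => 6 * (r.N : ℝ) - dens G r y U)
    (fun y _ => continuous_const.sub (continuous_dens r y))]
  congr 1
  exact Finset.sum_congr rfl fun y _ => torusE_const_sub G r β L _ (continuous_dens r y)

/-- **Deep-weak-coupling bound on the flowed response, uniformly in the volume AND IN THE UNIT.**  For every compact
`G`, every lattice representation `r`, every flow radius `ρ₀` and Schwartz weights with `|w| ≤ C_w`, `|v| ≤ C_v` there
is `K ≥ 0` such that for EVERY unit `a`, every odd torus `2L+1 ≥ 3` and every `β ≥ 1`: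
`|resp(β, L)| ≤ K · (2L+1)⁸ · (1 + log β)/β`.
Mechanism: `resp = Cov_T(X̂_w∘Θ₀, Ṽ_v)` with `|X̂_w| ≤ 64 N ρ₀⁴ C_w (2L+1)⁴` (unitarity of the flow) and
`E_T|Ṽ_v − 6N Σ v| ≤ C_v (2L+1)⁴ · 6K₀(1 + log β)/β` (the tree's volume-uniform chessboard/Laplace budget of the mean
plaquette, `CouplingSumRule.exists_six_mul_sub_torusE_dens_le`).  Nothing here is small when `L ≍ ξ(β)`: the bound
is informative only in the deep-weak-coupling corner `(2L+1)⁸ ≪ β/log β`. [folklore] -/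
theorem abs_resp_le_weakCoupling (ρ₀ : ℝ) {w v : SchwartzMap (EuclideanSpace ℝ (Fin 4)) ℝ} {Cw Cv : ℝ}
    (hw : ∀ z, |w z| ≤ Cw) (hv : ∀ z, |v z| ≤ Cv) :
    ∃ K : ℝ, 0 ≤ K ∧ ∀ (a : ℝ → ℝ) (L : ℕ), 1 ≤ L → ∀ β : ℝ, 1 ≤ β →
      |resp G r a ρ₀ w v β L| ≤ K * ((2 * L + 1 : ℕ) : ℝ) ^ 8 * (1 + Real.log β) / β := by
  obtain ⟨K₀, hK₀, hbud⟩ := exists_six_mul_sub_torusE_dens_le G r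
  have hCw : 0 ≤ Cw := (abs_nonneg _).trans (hw 0)
  have hCv : 0 ≤ Cv := (abs_nonneg _).trans (hv 0)
  refine ⟨2 * (Cw * (ρ₀ ^ 4 * (64 * r.N))) * (Cv * (6 * K₀)), by positivity, fun a L hL β hβ => ?_⟩
  set n : ℝ := ((2 * L + 1 : ℕ) : ℝ) with hn
  have hn0 : 0 ≤ n := by positivity
  -- the response as a covariance against the reflected probe
  have hF : Continuous fun U : LGConfig 4 G => probe G r a ρ₀ w β L (cfgReflect U) :=
    (continuous_probe r a ρ₀ w β L).comp continuous_cfgReflect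
  have hK : ∀ U : LGConfig 4 G, |probe G r a ρ₀ w β L (cfgReflect U)| ≤ n ^ 4 * (Cw * (ρ₀ ^ 4 * (64 * r.N))) :=
    fun U => abs_probe_le r a ρ₀ w hw β L (cfgReflect U)
  have h1 := abs_torusCov_le G r β L hF (continuous_leg r a v β L) hK (6 * r.N * ∑ y ∈ box 4 L, v (a β • siteToE y))
  have h2 := torusE_abs_leg_sub_le G r a v hv β L
  have h3 : ∑ y ∈ box 4 L, (6 * (r.N : ℝ) - torusE G r β L (dens G r y)) ≤ n ^ 4 * (6 * K₀ * (1 + Real.log β) / β) := by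
    refine (Finset.sum_le_sum fun y _ => hbud L hL β hβ y).trans (le_of_eq ?_)
    rw [Finset.sum_const, card_box, nsmul_eq_mul, hn]
    push_cast
    ring
  have hlog : 0 ≤ (1 + Real.log β) / β := div_nonneg (by linarith [Real.log_nonneg hβ]) (by linarith)
  unfold resp
  rw [← torusE_comp_cfgReflect G r β L (probe G r a ρ₀ w β L)]
  calc |torusE G r β L (fun U => probe G r a ρ₀ w β L (cfgReflect U) * leg G r a v β L U) -
        torusE G r β L (fun V => probe G r a ρ₀ w β L (cfgReflect V)) * torusE G r β L (leg G r a v β L)|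
      ≤ 2 * (n ^ 4 * (Cw * (ρ₀ ^ 4 * (64 * r.N)))) *
          torusE G r β L (fun U => |leg G r a v β L U - 6 * r.N * ∑ y ∈ box 4 L, v (a β • siteToE y)|) := h1
    _ ≤ 2 * (n ^ 4 * (Cw * (ρ₀ ^ 4 * (64 * r.N)))) * (Cv * (n ^ 4 * (6 * K₀ * (1 + Real.log β) / β))) :=
        mul_le_mul_of_nonneg_left (h2.trans (mul_le_mul_of_nonneg_left h3 hCv)) (by positivity)
    _ = 2 * (Cw * (ρ₀ ^ 4 * (64 * r.N))) * (Cv * (6 * K₀)) * n ^ 8 * (1 + Real.log β) / β := by ring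

end Torus

end Summit.QuantumFields.YangMills.Cruxes.FlowedResponseFloor.WindowSplit

end
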